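import Summits.QuantumFields.BalabanUV.T4Continuum.Support.ShellMeasureLandauCorrectionB7

/-!
# `T4Continuum.ShellMeasureLandauPinnedBudget` — FINDING F-ne7cleaf06g9-1: THE PINNED CONTRACTION BUDGET `hk` OF THE END HOSTS
# IS PINNED TO BAŁABAN's CONSTANTS, NOT TO THE FIELD (`2·C2cov d·landauRad d L = 1`), AND WHAT IT THEN DEMANDS
(cell `pub-balaban`, sub-cell `t4`, spine estimate NE7c (node U5b); NE7c ROUND-2 crew, unit
`b2b-balaban-t4-ne7c-formalise-leaf-06` gen 9; own-initiative FINDING of an idle seat, journal NOTE∕FINDING line of this gen;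
ADDITIVE — imports S64 `ShellMeasureLandauCorrectionB7` (`landauRad`, through it `C1cov C2cov` of S56 f3 and `c3` of
[B7] Prop. 3 flat) ONLY; [folklore]; 0 `def`, 0 `def … : Prop`, 0 sorry, 0 citation tags; touches NO host)

HONEST FRAMING.  Arithmetic on OUR displayed letters and two elementary consequences; nothing about Bałaban's minimiser,
propagators or kernels is computed, asserted or discharged; equation numbers below are LOCATORS of printed SHAPES.  Finite
four-torus programme, rung (B)+1 only — NOT infinite volume, NOT a mass gap, NOT the Clay problem, NOT summit progress;
NE7c (`T4IndicatorShell.ShellWeightBound`) NOT PRINTED, NOT PROVED; «NE7c ⇐ the named binders» (c3).  HONEST DEPENDENCY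
(cell): continuum YM on T⁴ ⇐ BetaPertH ∧ nine spine estimates (0/9 proved); BetaPertH ⇐ (D1) ∧ (D4) ∧ CAP+tail; G-an2-4
gates asym, D1 and NE2/3/4.

THE POINT.  Every END host since S99 f3b (R11 discharged: the w-tuple's Landau radius instantiated `RCw := landauRad d L`)
— S104 f2∕f4, S108–S110, THE ONE CALL v2∕v3∕v4 — displays the (T2) pinned-chain contraction budget (census row R22, class T)
`hk : 2·C2cov d·landauRad d L·e^{δw·rC}·(cι·Mι)·(cH·MH) < 1`,
inherited from S81 f1 `ShellMeasureLandauPinnedLipschitz.hCp_of_local` (Lipschitz constant `L_C = 2C₂R·e^{δ′r_C}` of the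
local (44)-letter on the flat ball `R∕2` — a Cauchy estimate on the ANALYTICITY radius `R`, not on the field size).
§1: `landauRad d L = min(1∕(24·C1cov d), c₃(d,L)∕2)` and `C2cov d = 12·C1cov d` give `2·C2cov d·landauRad d L ≤ 1` ALWAYS
and `= 1` EXACTLY whenever `L ≤ 12288(d+1)` (d = 4: `landauRad 4 L = 1∕78 643 200` for `L ≤ 61 440`), so the displayed row
READS `e^{δw·rC}·(cι·Mι)·(cH·MH) < 1` — a smallness of the PRODUCT OF TWO SCHUR BOUNDS OF BAŁABAN-TYPE LETTERS, with NO
field-size factor (§1b, contributed by leaf-10-g13 (journal l.22584): the CLOSED FORM for every `L` is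
`2·C2cov d·landauRad d L = min 1 (12288(d+1)∕L)`, so for `L > 12288(d+1)` the row reads `… < L∕(12288(d+1))` — still no
field-size factor; the TYPE objection holds for EVERY `L`, the inhabitability objection of §3 is an `L`-ceiling on the product).  Print's contraction for the same map ([Balaban1985Variational] p. 286 (53)–(54): «contractive if
`9C₂B₀ε₃ < 1`») is FIELD-SIZE based (`ε₃` = the field radius), as are the host's own flat rows `h18 : 18·C2cov·B₀·ε₃ ≤ 1`
(u-tuple) and `hqw : 9·C2cov·B₀w·(ε₄w + B₀w·bw) < 1` (w-tuple).
§2: for the DESIGNED restriction letter `ι` (a unit entry at zero distance — owner R-ne7cp1-g36-10: «a norm-one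
restriction letter») the displayed decay row `hkι` forces `1 ≤ cι` and the displayed reduced-rate row sum `hMι′` forces
`1 ≤ Mι` as soon as `dis x x = 0` at one occupied position (S110's `pl1 (x − x) = 0`); hence `hk` DEMANDS
`cH·MH < e^{−δw·rC} ≤ 1` of the (46)-letter `H` — whereas (45) «`LʲηQ_jHB = B`» makes `H` a right inverse of an averaging
(READING: in the units of (46) a right inverse of a norm-≤1 map has bound ≥ 1), and [B9] Thm 3.12's `B₀` is not printed `< 1`.
§3: if the `H`-letter reproduces ONE nonzero datum up to norm (`‖X‖ ≤ ‖kerOp (kH V) X‖`, the (45) reading) then any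
admissible Schur product has `cH·MH ≥ 1` and `hk` is FALSE (`not_hk_of_designed`).  NEVER EXERCISED: every G-1 witness of these
hosts (S88, S104 f3, S96∕S106 toys) takes ZERO w-kernels (`cι = cH = 0`), where `hk` is `0 < 1`.
REPAIR (host level, no new mathematics; the owner schedules — it changes the conclusion's spelling, so it is NOT a link of the
current chain): instantiate the w-tuple's Landau radius at the FIELD radius, `RCw := 6·(ε₄w + B₀w·bw)` (the kernel pair
`hCq∕hCd` on `ball 0 landauRad` RESTRICTS to the smaller ball by the displayed `hRCw : 6(ε₄w + B₀w·bw) ≤ landauRad` —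
`quadPair_restrict` below), whereupon the budget reads `hk♯ : 12·C2cov·(ε₄w + B₀w·bw)·e^{δw·rC}·(cι·Mι)·(cH·MH) < 1` —
print's (54) TYPE, jointly inhabitable with `cι·Mι ≥ 1` and ANY `cH·MH` given the (already displayed) smallness of the field —
and the slot constant's factor `(1 − 2·C2cov·landauRad·…)` becomes `(1 − 12·C2cov·(ε₄w + B₀w·bw)·…)`; alternatively re-prove
`hCp_of_local` with the Schwarz-lemma Lipschitz constant `4C₂‖Z₀‖e^{δ′r_C}` (`DC(0) = 0`).  WHAT THIS FILE DOES NOT DO: touch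
any host; assert `B₀ ≥ 1` for Bałaban's `H` (a READING of (45)–(46), stated as the hypothesis `hH : 1 ≤ cH·MH` ∕ `hrep`);
discharge anything of Bałaban's.  NOTHING in the countdown moves.
-/

noncomputable section

open scoped BigOperators

namespace Summit.QuantumFields.BalabanUV.T4Continuum.ShellMeasureLandauPinnedBudget

open Literature.MathematicalPhysics.QuantumFieldTheory.Balaban1983to89
open B7Prop3Flat (c3 c3_pos)
open ShellMeasureAverageProp4General (C1cov C2cov C1cov_pos)
open ShellMeasureLandauCorrectionB7 (landauRad landauRad_pos)

/-! ## §1 The w-tuple's Landau radius: `2·C2cov d·landauRad d L = 1` -/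

/-- `2·C2cov d·landauRad d L ≤ 1` for every `d, L` (`C2cov = 12·C1cov`, `landauRad ≤ 1∕(24·C1cov)`). [folklore] -/
theorem two_mul_C2cov_mul_landauRad_le_one (d L : ℕ) : 2 * C2cov d * landauRad d L ≤ 1 := by
  have hC := C1cov_pos d
  have h1 : landauRad d L ≤ 1 / (24 * C1cov d) := min_le_left _ _
  unfold C2cov
  calc 2 * (12 * C1cov d) * landauRad d L ≤ 2 * (12 * C1cov d) * (1 / (24 * C1cov d)) :=
        mul_le_mul_of_nonneg_left h1 (by positivity)
    _ = 1 := by field_simp; ring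

/-- **`2·C2cov d·landauRad d L = 1`** whenever `1 ≤ L ≤ 12288·(d+1)` (then `landauRad = 1∕(24·C1cov d)`: the bracket
`c₃(d,L)∕2 = 1∕(256(d+1)L)` is the larger of the two radii). [folklore] -/
theorem two_mul_C2cov_mul_landauRad_eq_one {d L : ℕ} (hL : 1 ≤ L) (hLd : (L : ℝ) ≤ 12288 * ((d : ℝ) + 1)) :
    2 * C2cov d * landauRad d L = 1 := by
  have hC := C1cov_pos d
  have hL0 : (0 : ℝ) < L := by exact_mod_cast hL
  have hmin : landauRad d L = 1 / (24 * C1cov d) := by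
    unfold landauRad
    apply min_eq_left
    unfold c3 C1cov
    rw [div_div, show (128 * ((d : ℝ) + 1) * L) * 2 = 256 * ((d : ℝ) + 1) * L by ring]
    apply one_div_le_one_div_of_le (by positivity)
    nlinarith [mul_le_mul_of_nonneg_left hLd (by positivity : (0 : ℝ) ≤ 256 * ((d : ℝ) + 1))]
  rw [hmin]
  unfold C2cov
  field_simp
  ring

/-- the four-dimensional numbers: `C1cov 4 = 3 276 800`, `C2cov 4 = 39 321 600`, and for `1 ≤ L ≤ 61 440`
`landauRad 4 L = 1∕78 643 200`, `2·C2cov 4·landauRad 4 L = 1`. [folklore] -/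
theorem numbers_d4 {L : ℕ} (hL : 1 ≤ L) (hL' : (L : ℝ) ≤ 61440) :
    C1cov 4 = 3276800 ∧ C2cov 4 = 39321600 ∧ landauRad 4 L = 1 / 78643200 ∧ 2 * C2cov 4 * landauRad 4 L = 1 := by
  have h := two_mul_C2cov_mul_landauRad_eq_one (d := 4) hL (hL'.trans (by norm_num))
  have h1 : C1cov 4 = 3276800 := by unfold C1cov; norm_num
  have h2 : C2cov 4 = 39321600 := by unfold C2cov; rw [h1]; norm_num
  refine ⟨h1, h2, ?_, h⟩
  rw [h2] at h
  linarith

/-- **THE DISPLAYED ROW `hk` READ AT §1's IDENTITY**: `2·C2cov·landauRad·E·A·B < 1 ↔ E·A·B < 1` — no field-size factor is left. [folklore] -/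
theorem hk_iff {d L : ℕ} (hL : 1 ≤ L) (hLd : (L : ℝ) ≤ 12288 * ((d : ℝ) + 1)) (E A B : ℝ) :
    2 * C2cov d * landauRad d L * E * A * B < 1 ↔ E * A * B < 1 := by
  rw [two_mul_C2cov_mul_landauRad_eq_one hL hLd, one_mul]

/-! ## §1b The closed form for every `L` (contributed by leaf-10-g13, journal l.22584; re-homed here verbatim up to names) -/

/-- **the closed form for every `L ≥ 1`**: `2·C2cov d·landauRad d L = min 1 (12288·(d+1)∕L)`
(`2·12·C1cov·min(1∕(24 C1cov), c₃∕2) = min(1, 12·C1cov·c₃)` and `12·131072(d+1)²∕(128(d+1)L) = 12288(d+1)∕L`). [folklore] -/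
theorem two_mul_C2cov_mul_landauRad_eq (d : ℕ) {L : ℕ} (hL : 1 ≤ L) :
    2 * C2cov d * landauRad d L = min 1 (12288 * ((d : ℝ) + 1) / L) := by
  have hC := C1cov_pos d
  have hL0 : (0 : ℝ) < L := by exact_mod_cast hL
  unfold landauRad C2cov
  rw [mul_min_of_nonneg _ _ (by positivity)]
  congr 1
  · field_simp
    ring
  · unfold c3 C1cov
    field_simp
    ring

/-- the large-`L` branch: for `12288·(d+1) ≤ L` the factor is `12288(d+1)∕L ≤ 1`. [folklore] -/
theorem two_mul_C2cov_mul_landauRad_eq_of_le {d L : ℕ} (hLd : 12288 * ((d : ℝ) + 1) ≤ L) :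
    2 * C2cov d * landauRad d L = 12288 * ((d : ℝ) + 1) / L := by
  have hL0 : (0 : ℝ) < L := lt_of_lt_of_le (by positivity) hLd
  have hL : 1 ≤ L := by
    have : (0 : ℝ) < (L : ℝ) := hL0
    exact_mod_cast Nat.one_le_iff_ne_zero.mpr (by rintro rfl; simp at this)
  rw [two_mul_C2cov_mul_landauRad_eq d hL]
  exact min_eq_right ((div_le_one hL0).2 hLd)

/-- **`hk` READ ON THE LARGE-`L` BRANCH**: `2·C2cov·landauRad·E·A·B < 1 ↔ E·A·B < L∕(12288(d+1))` — still no field-size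
factor; the ceiling on the product of the two Schur bounds grows linearly with `L`. [folklore] -/
theorem hk_iff_of_le {d L : ℕ} (hLd : 12288 * ((d : ℝ) + 1) ≤ L) (E A B : ℝ) :
    2 * C2cov d * landauRad d L * E * A * B < 1 ↔ E * A * B < L / (12288 * ((d : ℝ) + 1)) := by
  have hD : (0 : ℝ) < 12288 * ((d : ℝ) + 1) := by positivity
  have hL0 : (0 : ℝ) < L := lt_of_lt_of_le hD hLd
  rw [two_mul_C2cov_mul_landauRad_eq_of_le hLd, lt_div_iff₀ hD]
  constructor
  · intro h
    have := mul_lt_mul_of_pos_right h hL0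
    calc E * A * B * (12288 * ((d : ℝ) + 1)) = 12288 * ((d : ℝ) + 1) / L * E * A * B * L := by
          field_simp
      _ < 1 * L := this
      _ = L := one_mul _
  · intro h
    have := div_lt_div_of_pos_right h hL0
    calc 12288 * ((d : ℝ) + 1) / L * E * A * B = E * A * B * (12288 * ((d : ℝ) + 1)) / L := by ring
      _ < L / L := this
      _ = 1 := div_self hL0.ne'

/-- sanity (d = 4, L = 10⁶ > 61 440): the factor is `61440∕10⁶`, so `hk ↔ E·A·B < 16.276…`. [folklore] -/
theorem numbers_d4_largeL : 2 * C2cov 4 * landauRad 4 1000000 = 61440 / 1000000 := by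
  rw [two_mul_C2cov_mul_landauRad_eq_of_le (by norm_num)]
  norm_num

/-! ## §2 What the displayed decay ∕ row-sum rows force for a restriction-type letter, and what `hk` then demands of `H` -/

section Schur

variable {𝒱 Λ Λ' 𝔖 : Type*} [Fintype Λ] {𝔄 𝔅 : Type*} [NormedAddCommGroup 𝔄] [NormedSpace ℂ 𝔄]
  [NormedAddCommGroup 𝔅] [NormedSpace ℂ 𝔅]

omit [Fintype Λ] in
/-- a kernel family with ONE entry of norm `≥ 1` at distance `0` (the designed restriction letter) has decay constant
`c ≥ 1` in the hosts' row `hkι : ‖k V a b‖ ≤ c·e^{−δ·dis(pos′ a, pos b)}`. [folklore] -/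
theorem one_le_c_of_unitEntry (k : 𝒱 → Λ' → Λ → (𝔄 →L[ℂ] 𝔅)) (dis : 𝔖 → 𝔖 → ℝ) (pos' : Λ' → 𝔖) (pos : Λ → 𝔖)
    {c δ : ℝ} (hk : ∀ V a b, ‖k V a b‖ ≤ c * Real.exp (-(δ * dis (pos' a) (pos b))))
    {V₀ : 𝒱} {a₀ : Λ'} {b₀ : Λ} (h0 : dis (pos' a₀) (pos b₀) = 0) (h1 : 1 ≤ ‖k V₀ a₀ b₀‖) : 1 ≤ c := by
  have h := hk V₀ a₀ b₀
  rw [h0, mul_zero, neg_zero, Real.exp_zero, mul_one] at h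
  linarith

/-- the hosts' reduced-rate row-sum row `hM′ : ∀ x, Σ_b e^{−a·dis(x, pos b)} ≤ M` forces `M ≥ 1` as soon as ONE occupied
position has self-distance `0` (S110's `pl1 (x − x) = 0`). [folklore] -/
theorem one_le_M_of_selfDist (dis : 𝔖 → 𝔖 → ℝ) (pos : Λ → 𝔖) {a M : ℝ}
    (hM : ∀ x, ∑ b, Real.exp (-(a * dis x (pos b))) ≤ M) {b₀ : Λ} (hself : dis (pos b₀) (pos b₀) = 0) : 1 ≤ M := by
  have h := hM (pos b₀)
  have h1 : Real.exp (-(a * dis (pos b₀) (pos b₀))) ≤ ∑ b, Real.exp (-(a * dis (pos b₀) (pos b))) :=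
    Finset.single_le_sum (f := fun b => Real.exp (-(a * dis (pos b₀) (pos b)))) (fun b _ => (Real.exp_pos _).le)
      (Finset.mem_univ b₀)
  rw [hself, mul_zero, neg_zero, Real.exp_zero] at h1
  linarith

/-- hence the Schur product of the designed restriction letter is `≥ 1`. [folklore] -/
theorem one_le_schur_of_restriction (k : 𝒱 → Λ' → Λ → (𝔄 →L[ℂ] 𝔅)) (dis : 𝔖 → 𝔖 → ℝ) (pos' : Λ' → 𝔖)
    (pos : Λ → 𝔖) {c δ δw M : ℝ} (hk : ∀ V a b, ‖k V a b‖ ≤ c * Real.exp (-(δ * dis (pos' a) (pos b))))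
    (hM : ∀ x, ∑ b, Real.exp (-((δ - δw) * dis x (pos b))) ≤ M)
    {V₀ : 𝒱} {a₀ : Λ'} {b₀ : Λ} (h0 : dis (pos' a₀) (pos b₀) = 0) (h1 : 1 ≤ ‖k V₀ a₀ b₀‖)
    (hself : dis (pos b₀) (pos b₀) = 0) : 1 ≤ c * M := by
  have hc := one_le_c_of_unitEntry k dis pos' pos hk h0 h1
  have hM1 := one_le_M_of_selfDist dis pos hM hself
  nlinarith

/-- a map that reproduces ONE nonzero datum up to norm (`‖x₀‖ ≤ ‖T x₀‖` — the (45) reading «`LʲηQ_jHB = B`» with a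
norm-≤1 average) has every admissible operator bound `K ≥ 1`. [folklore] -/
theorem one_le_bound_of_reproducing {X Y : Type*} [NormedAddCommGroup X] [NormedAddCommGroup Y] (T : X → Y) {K : ℝ}
    (hT : ∀ x, ‖T x‖ ≤ K * ‖x‖) {x₀ : X} (hx₀ : x₀ ≠ 0) (hrep : ‖x₀‖ ≤ ‖T x₀‖) : 1 ≤ K := by
  have hpos : 0 < ‖x₀‖ := norm_pos_iff.2 hx₀
  have h : 1 * ‖x₀‖ ≤ K * ‖x₀‖ := by rw [one_mul]; exact hrep.trans (hT x₀)
  exact le_of_mul_le_mul_right h hpos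

end Schur

/-! ## §3 `hk` demands `cH·MH < e^{−δw·rC}`; with a reproducing `H`-letter it is false -/

/-- elementary: `E·P·Q < 1`, `E > 0`, `P ≥ 1`, `Q ≥ 0` ⟹ `Q < 1∕E`. [folklore] -/
theorem lt_one_div_of_budget {E P Q : ℝ} (hE : 0 < E) (hP : 1 ≤ P) (hQ : 0 ≤ Q) (h : E * P * Q < 1) : Q < 1 / E := by
  have h1 : E * Q ≤ E * P * Q := by nlinarith [mul_nonneg (mul_nonneg hE.le hQ) (sub_nonneg.2 hP)]
  rw [lt_div_iff₀ hE]
  linarith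

/-- **WHAT THE DISPLAYED `hk` DEMANDS OF THE (46)-LETTER**: with the designed restriction letter (`1 ≤ cι·Mι`) and any sign
row `0 ≤ cH·MH`, the END hosts' `hk : 2·C2cov d·landauRad d L·e^{δw·rC}·(cι·Mι)·(cH·MH) < 1` (for `1 ≤ L ≤ 12288(d+1)`)
forces `cH·MH < e^{−δw·rC}` — a smallness of `H`'s Schur bound, with no field-size factor. [folklore] -/
theorem cH_mul_MH_lt_of_hk {d L : ℕ} (hL : 1 ≤ L) (hLd : (L : ℝ) ≤ 12288 * ((d : ℝ) + 1))
    {δw rC cι Mι cH MH : ℝ} (hι : 1 ≤ cι * Mι) (hH : 0 ≤ cH * MH)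
    (hk : 2 * C2cov d * landauRad d L * Real.exp (δw * rC) * (cι * Mι) * (cH * MH) < 1) :
    cH * MH < Real.exp (-(δw * rC)) := by
  rw [hk_iff hL hLd] at hk
  have h := lt_one_div_of_budget (Real.exp_pos _) hι hH hk
  rwa [Real.exp_neg, ← one_div]

/-- … and `cH·MH < 1` once the pin data are nonnegative (`0 ≤ δw·rC`: the hosts display `0 ≤ δw`; the reach `rC ≥ 0` by
design). [folklore] -/
theorem cH_mul_MH_lt_one_of_hk {d L : ℕ} (hL : 1 ≤ L) (hLd : (L : ℝ) ≤ 12288 * ((d : ℝ) + 1))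
    {δw rC cι Mι cH MH : ℝ} (hpin : 0 ≤ δw * rC) (hι : 1 ≤ cι * Mι) (hH : 0 ≤ cH * MH)
    (hk : 2 * C2cov d * landauRad d L * Real.exp (δw * rC) * (cι * Mι) * (cH * MH) < 1) : cH * MH < 1 :=
  (cH_mul_MH_lt_of_hk hL hLd hι hH hk).trans_le (Real.exp_le_one_iff.2 (by linarith))

/-- **`hk` IS FALSE FOR A LETTER PAIR OF THE DESIGNED TYPE**: restriction letter (`1 ≤ cι·Mι`, §2) + an `H`-letter whose Schur
product is `≥ 1` (e.g. by `one_le_bound_of_reproducing` under the (45) reading) + nonnegative pin data ⟹ the displayed row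
`hk` of the END hosts cannot hold (`1 ≤ L ≤ 12288(d+1)`).  The hypotheses `hι hH` are READINGS of the designed objects,
displayed here, asserted by nobody. [folklore] -/
theorem not_hk_of_designed {d L : ℕ} (hL : 1 ≤ L) (hLd : (L : ℝ) ≤ 12288 * ((d : ℝ) + 1))
    {δw rC cι Mι cH MH : ℝ} (hpin : 0 ≤ δw * rC) (hι : 1 ≤ cι * Mι) (hH : 1 ≤ cH * MH) :
    ¬ 2 * C2cov d * landauRad d L * Real.exp (δw * rC) * (cι * Mι) * (cH * MH) < 1 := fun hk =>
  absurd (cH_mul_MH_lt_one_of_hk hL hLd hpin hι (by linarith) hk) (not_lt.2 hH)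

/-! ## §4 The repair's mechanism: the kernel (44)-pair restricts to the field ball -/

section Repair

variable {𝔄 𝔅 : Type*} [NormedAddCommGroup 𝔄] [NormedSpace ℂ 𝔄] [NormedAddCommGroup 𝔅] [NormedSpace ℂ 𝔅]

/-- the displayed (44)-pair `hCq ∕ hCd` on `ball 0 R` RESTRICTS to any `R′ ≤ R` (so a host may instantiate the w-tuple's Landau
radius at the field radius `R′ := 6(ε₄w + B₀w·bw) ≤ landauRad`, turning `hk` into the field-size-based
`12·C2cov·(ε₄w + B₀w·bw)·e^{δw rC}·(cιMι)(cHMH) < 1` of print's (54) TYPE). [folklore] -/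
theorem quadPair_restrict {C : 𝔄 → 𝔅} {C₂ R R' : ℝ} (hR : R' ≤ R)
    (hCq : ∀ Z : 𝔄, ‖Z‖ < R → ‖C Z‖ ≤ C₂ * ‖Z‖ ^ 2) (hCd : DifferentiableOn ℂ C (Metric.ball 0 R)) :
    (∀ Z : 𝔄, ‖Z‖ < R' → ‖C Z‖ ≤ C₂ * ‖Z‖ ^ 2) ∧ DifferentiableOn ℂ C (Metric.ball 0 R') :=
  ⟨fun Z hZ => hCq Z (hZ.trans_le hR), hCd.mono (Metric.ball_subset_ball hR)⟩

/-- the repaired budget's arithmetic: at `R′ = 6X` the factor `2·C₂·R′` is `12·C₂·X`. [folklore] -/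
theorem repaired_budget_factor (C₂ X : ℝ) : 2 * C₂ * (6 * X) = 12 * C₂ * X := by ring

end Repair

end Summit.QuantumFields.BalabanUV.T4Continuum.ShellMeasureLandauPinnedBudget

end
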